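import Mathlib

/-!
# Low-density assembly, counting part — aux for stub `stub_lowDensityAssembly` of line `Sketch`,
crux stmt-PneNP-2463 (`SolvableImpliesStableSection`)

The two union bounds of the assembly of the low-density block.  A path tuple
`Ψ : Fin (k+1) → (Fin m → Fin k → Fin n × Bool)` is *bad* if either

* (Hall part) some splice instance `P r q` (`r : Fin k`, `q ≤ mk`) violates Hall's condition, or
* (component part) some clause-sharing component of some pooled pair `(Ψ r.castSucc, Ψ r.succ)` has
  `≥ u` clauses.

`lds_hallBad_card`: the first kind is bounded by the union over the `k(mk+1)` splice points of the
Hall-failure first moment `hHall` (a hypothesis here — it is another stub of the line), hence by `#Paths/4`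
under the smallness assumption (i) of the asymptotics.  `lds_compBad_card` (principal): a component with
`≥ u` clauses contains a BFS witness (`hBfs`: an injective enumeration `f : Fin u → Fin m` with a monotone
parent map `p`, `p i < i`, consecutive clauses adjacent), so the second kind is bounded by the union over
`(r, f, p)` of the peeling first moment `hPeel`, i.e. by `k · m^u · 4^u · ((2k)²/n)^(u-1) · #Paths ≤ #Paths/4`
under the smallness assumption (ii).
-/

set_option linter.dupNamespace false

namespace Summit.PneNP.PneNP.Cruxes.SolvableImpliesStableSection.Sketch

open Finset
open scoped Classical

/-- **Union bound, Hall part.** The path tuples with some Hall-violating splice instance `P r q`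
(`q ≤ mk`) are at most `k (mk+1)` times the one-splice-point bound `hHall`, hence at most `#Paths / 4`
under the smallness hypothesis `hsmall` (conjunct (i) of the asymptotics). -/
theorem lds_hallBad_card (k m n : ℕ) (hk : 1 ≤ k) (hn : 1 ≤ n) (hmn : m ≤ n)
    (hHall : ∀ (k m n : ℕ), 1 ≤ k → 1 ≤ n → m ≤ n → ∀ (r : Fin k) (q : ℕ),
      (((Finset.univ : Finset (Fin (k + 1) → Fin m → Fin k → Fin n × Bool)).filter fun Ψ =>
          ∃ T : Finset (Fin m),
            (T.biUnion fun i => Finset.univ.image fun j : Fin k =>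
              (if (i : ℕ) * k + j < q then Ψ r.succ i j else Ψ r.castSucc i j).1).card < T.card).card : ℝ)
        ≤ (Fintype.card (Fin (k + 1) → Fin m → Fin k → Fin n × Bool) : ℝ) *
          ∑ c ∈ Finset.Icc 2 m, ((m.choose c : ℕ) : ℝ) * ((n.choose (c - 1) : ℕ) : ℝ) *
            (((c - 1 : ℕ) : ℝ) / n) ^ (k * c))
    (hsmall : (k : ℝ) * ((m : ℝ) * k + 1) *
        (∑ c' ∈ Finset.Icc 2 m, ((m.choose c' : ℕ) : ℝ) *
          ((n.choose (c' - 1) : ℕ) : ℝ) * (((c' - 1 : ℕ) : ℝ) / n) ^ (k * c')) ≤ 1 / 4) :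
    (((Finset.univ : Finset (Fin (k + 1) → Fin m → Fin k → Fin n × Bool)).filter fun Ψ =>
        ∃ r : Fin k, ∃ q : ℕ, q ≤ m * k ∧ ∃ T : Finset (Fin m),
          (T.biUnion fun i => Finset.univ.image fun j : Fin k =>
            (if (i : ℕ) * k + j < q then Ψ r.succ i j else Ψ r.castSucc i j).1).card < T.card).card : ℝ)
      ≤ (Fintype.card (Fin (k + 1) → Fin m → Fin k → Fin n × Bool) : ℝ) / 4 := by
  set N := Fintype.card (Fin (k + 1) → Fin m → Fin k → Fin n × Bool) with hN
  set Sc : ℝ := ∑ c' ∈ Finset.Icc 2 m, ((m.choose c' : ℕ) : ℝ) *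
          ((n.choose (c' - 1) : ℕ) : ℝ) * (((c' - 1 : ℕ) : ℝ) / n) ^ (k * c') with hSc
  set Bad : Fin k → ℕ → Finset (Fin (k + 1) → Fin m → Fin k → Fin n × Bool) := fun r q =>
    (Finset.univ : Finset (Fin (k + 1) → Fin m → Fin k → Fin n × Bool)).filter fun Ψ =>
      ∃ T : Finset (Fin m),
        (T.biUnion fun i => Finset.univ.image fun j : Fin k =>
          (if (i : ℕ) * k + j < q then Ψ r.succ i j else Ψ r.castSucc i j).1).card < T.card
    with hBad
  set B : Finset (Fin (k + 1) → Fin m → Fin k → Fin n × Bool) :=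
    (Finset.univ : Finset (Fin (k + 1) → Fin m → Fin k → Fin n × Bool)).filter fun Ψ =>
        ∃ r : Fin k, ∃ q : ℕ, q ≤ m * k ∧ ∃ T : Finset (Fin m),
          (T.biUnion fun i => Finset.univ.image fun j : Fin k =>
            (if (i : ℕ) * k + j < q then Ψ r.succ i j else Ψ r.castSucc i j).1).card < T.card
    with hB
  -- union bound over the k (mk+1) splice points
  have hsub : B ⊆ (Finset.univ : Finset (Fin k)).biUnion fun r =>
      (Finset.range (m * k + 1)).biUnion fun q => Bad r q := by
    intro Ψ hΨ
    simp only [hB, Finset.mem_filter, Finset.mem_univ, true_and] at hΨ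
    obtain ⟨r, q, hq, T, hT⟩ := hΨ
    simp only [Finset.mem_biUnion, Finset.mem_univ, true_and, Finset.mem_range]
    refine ⟨r, q, Nat.lt_succ_of_le hq, ?_⟩
    simp only [hBad, Finset.mem_filter, Finset.mem_univ, true_and]
    exact ⟨T, hT⟩
  have hcard : B.card ≤ ∑ r : Fin k, ∑ q ∈ Finset.range (m * k + 1), (Bad r q).card :=
    (Finset.card_le_card hsub).trans (Finset.card_biUnion_le.trans
      (Finset.sum_le_sum fun r _ => Finset.card_biUnion_le))
  have hone : ∀ (r : Fin k) (q : ℕ), ((Bad r q).card : ℝ) ≤ (N : ℝ) * Sc := fun r q =>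
    hHall k m n hk hn hmn r q
  have hreal : (B.card : ℝ) ≤ ∑ _r : Fin k, ∑ _q ∈ Finset.range (m * k + 1), (N : ℝ) * Sc := by
    calc (B.card : ℝ) ≤ ((∑ r : Fin k, ∑ q ∈ Finset.range (m * k + 1), (Bad r q).card : ℕ) : ℝ) := by
          exact_mod_cast hcard
      _ = ∑ r : Fin k, ∑ q ∈ Finset.range (m * k + 1), ((Bad r q).card : ℝ) := by push_cast; rfl
      _ ≤ ∑ _r : Fin k, ∑ _q ∈ Finset.range (m * k + 1), (N : ℝ) * Sc :=
          Finset.sum_le_sum fun r _ => Finset.sum_le_sum fun q _ => hone r q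
  rw [Finset.sum_const, Finset.sum_const, Finset.card_range, Finset.card_univ, Fintype.card_fin,
    nsmul_eq_mul, nsmul_eq_mul] at hreal
  have hN0 : (0 : ℝ) ≤ N := Nat.cast_nonneg _
  calc (B.card : ℝ) ≤ (k : ℝ) * (((m * k + 1 : ℕ) : ℝ) * ((N : ℝ) * Sc)) := hreal
    _ = (N : ℝ) * ((k : ℝ) * ((m : ℝ) * k + 1) * Sc) := by push_cast; ring
    _ ≤ (N : ℝ) * (1 / 4) := mul_le_mul_of_nonneg_left hsmall hN0
    _ = (N : ℝ) / 4 := by ring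

/-- **Union bound, component part (principal lemma of this file).** The path tuples having, for some
segment `r`, a clause-sharing component of the pooled pair `(Ψ r.castSucc, Ψ r.succ)` with `≥ u` clauses
are at most `#Paths / 4`: such a component contains a BFS witness `(f, p)` (`hBfs`), each witness is
realised by at most `((2k)²/n)^(u-1) · #Paths` tuples (`hPeel`), and there are at most `k · m^u · 4^u`
witnesses; conclude with the smallness hypothesis `hsmall` (conjunct (ii) of the asymptotics). -/
theorem lds_compBad_card (k m n : ℕ) (hn : 1 ≤ n) (u : ℕ) (hu : 1 ≤ u)
    (hBfs : (∀ {V : Type} [Fintype V] [DecidableEq V] (R : V → V → Prop) (a : V) (u : ℕ) (hu : 1 ≤ u),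
      (∃ e : Fin u → V, Function.Injective e ∧ ∀ i, Relation.ReflTransGen R a (e i)) →
      ∃ f : Fin u → V, Function.Injective f ∧ f ⟨0, hu⟩ = a ∧
        ∃ p : Fin u → Fin u, Monotone p ∧ ∀ i : Fin u, (i : ℕ) ≠ 0 → p i < i ∧ R (f (p i)) (f i)) ∧
      ∀ u : ℕ, Fintype.card {p : Fin u → Fin u // Monotone p} ≤ 4 ^ u)
    (hPeel : ∀ (k m n : ℕ), 1 ≤ n → ∀ (r : Fin k) (u : ℕ) (f : Fin u → Fin m),
      Function.Injective f → ∀ (p : Fin u → Fin u), (∀ i : Fin u, (i : ℕ) ≠ 0 → p i < i) →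
      (((Finset.univ : Finset (Fin (k + 1) → Fin m → Fin k → Fin n × Bool)).filter fun Ψ =>
          ∀ i : Fin u, (i : ℕ) ≠ 0 → ∃ j j' : Fin k, ∃ ρ ρ' : Fin (k + 1),
            (ρ = r.castSucc ∨ ρ = r.succ) ∧ (ρ' = r.castSucc ∨ ρ' = r.succ) ∧
            (Ψ ρ (f (p i)) j).1 = (Ψ ρ' (f i) j').1).card : ℝ) * (n : ℝ) ^ (u - 1)
        ≤ ((2 * k : ℝ) ^ 2) ^ (u - 1) *
          Fintype.card (Fin (k + 1) → Fin m → Fin k → Fin n × Bool))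
    (hsmall : (k : ℝ) * (m : ℝ) ^ u * (4 : ℝ) ^ u * ((2 * k : ℝ) ^ 2 / n) ^ (u - 1) ≤ 1 / 4) :
    (((Finset.univ : Finset (Fin (k + 1) → Fin m → Fin k → Fin n × Bool)).filter fun Ψ =>
        ∃ r : Fin k, ∃ a : Fin m, u ≤ (Finset.univ.filter fun a' : Fin m => Relation.ReflTransGen
          (fun a a' : Fin m => ∃ j j' : Fin k, ∃ ρ ρ' : Fin (k + 1),
            (ρ = r.castSucc ∨ ρ = r.succ) ∧ (ρ' = r.castSucc ∨ ρ' = r.succ) ∧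
            (Ψ ρ a j).1 = (Ψ ρ' a' j').1) a a').card).card : ℝ)
      ≤ (Fintype.card (Fin (k + 1) → Fin m → Fin k → Fin n × Bool) : ℝ) / 4 := by
  set N := Fintype.card (Fin (k + 1) → Fin m → Fin k → Fin n × Bool) with hN
  set B : Finset (Fin (k + 1) → Fin m → Fin k → Fin n × Bool) :=
    (Finset.univ : Finset (Fin (k + 1) → Fin m → Fin k → Fin n × Bool)).filter fun Ψ =>
        ∃ r : Fin k, ∃ a : Fin m, u ≤ (Finset.univ.filter fun a' : Fin m => Relation.ReflTransGen
          (fun a a' : Fin m => ∃ j j' : Fin k, ∃ ρ ρ' : Fin (k + 1),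
            (ρ = r.castSucc ∨ ρ = r.succ) ∧ (ρ' = r.castSucc ∨ ρ' = r.succ) ∧
            (Ψ ρ a j).1 = (Ψ ρ' a' j').1) a a').card with hB
  -- the index sets of the BFS witnesses and the witnessed events
  set Finj : Finset (Fin u → Fin m) := Finset.univ.filter fun f => Function.Injective f with hFinj
  set Pm : Finset (Fin u → Fin u) :=
    Finset.univ.filter fun p => Monotone p ∧ ∀ i : Fin u, (i : ℕ) ≠ 0 → p i < i with hPm
  set E : Fin k → (Fin u → Fin m) → (Fin u → Fin u) →
      Finset (Fin (k + 1) → Fin m → Fin k → Fin n × Bool) := fun r f p =>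
    (Finset.univ : Finset (Fin (k + 1) → Fin m → Fin k → Fin n × Bool)).filter fun Ψ =>
      ∀ i : Fin u, (i : ℕ) ≠ 0 → ∃ j j' : Fin k, ∃ ρ ρ' : Fin (k + 1),
        (ρ = r.castSucc ∨ ρ = r.succ) ∧ (ρ' = r.castSucc ∨ ρ' = r.succ) ∧
        (Ψ ρ (f (p i)) j).1 = (Ψ ρ' (f i) j').1 with hE
  -- every bad tuple realises some BFS witness
  have hsub : B ⊆ (Finset.univ : Finset (Fin k)).biUnion fun r =>
      Finj.biUnion fun f => Pm.biUnion fun p => E r f p := by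
    intro Ψ hΨ
    simp only [hB, Finset.mem_filter, Finset.mem_univ, true_and] at hΨ
    obtain ⟨r, a, hua⟩ := hΨ
    obtain ⟨t, htS, htcard⟩ := Finset.exists_subset_card_eq hua
    have hreach : ∀ i : Fin u, Relation.ReflTransGen
        (fun a a' : Fin m => ∃ j j' : Fin k, ∃ ρ ρ' : Fin (k + 1),
          (ρ = r.castSucc ∨ ρ = r.succ) ∧ (ρ' = r.castSucc ∨ ρ' = r.succ) ∧
          (Ψ ρ a j).1 = (Ψ ρ' a' j').1) a (t.orderEmbOfFin htcard i) := by
      intro i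
      have hi := htS (t.orderEmbOfFin_mem htcard i)
      simpa using hi
    obtain ⟨f, hf, -, p, hpm, hp⟩ := hBfs.1
      (fun a a' : Fin m => ∃ j j' : Fin k, ∃ ρ ρ' : Fin (k + 1),
        (ρ = r.castSucc ∨ ρ = r.succ) ∧ (ρ' = r.castSucc ∨ ρ' = r.succ) ∧
        (Ψ ρ a j).1 = (Ψ ρ' a' j').1) a u hu
      ⟨fun i => t.orderEmbOfFin htcard i, (t.orderEmbOfFin htcard).injective, hreach⟩
    simp only [Finset.mem_biUnion, Finset.mem_univ, true_and]
    refine ⟨r, f, ?_, p, ?_, ?_⟩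
    · simp only [hFinj, Finset.mem_filter, Finset.mem_univ, true_and]
      exact hf
    · simp only [hPm, Finset.mem_filter, Finset.mem_univ, true_and]
      exact ⟨hpm, fun i hi => (hp i hi).1⟩
    · simp only [hE, Finset.mem_filter, Finset.mem_univ, true_and]
      exact fun i hi => (hp i hi).2
  have hcard : B.card ≤ ∑ r : Fin k, ∑ f ∈ Finj, ∑ p ∈ Pm, (E r f p).card :=
    (Finset.card_le_card hsub).trans (Finset.card_biUnion_le.trans
      (Finset.sum_le_sum fun r _ => Finset.card_biUnion_le.trans
        (Finset.sum_le_sum fun f _ => Finset.card_biUnion_le)))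
  -- the peeling bound for one witness
  set C : ℝ := ((2 * k : ℝ) ^ 2) ^ (u - 1) * N / (n : ℝ) ^ (u - 1) with hC
  have hnpos : (0 : ℝ) < (n : ℝ) ^ (u - 1) := by positivity
  have hone : ∀ (r : Fin k), ∀ f ∈ Finj, ∀ p ∈ Pm, ((E r f p).card : ℝ) ≤ C := by
    intro r f hf p hp
    have hf' : Function.Injective f := by
      simpa [hFinj] using hf
    have hp' : ∀ i : Fin u, (i : ℕ) ≠ 0 → p i < i := by
      simp only [hPm, Finset.mem_filter, Finset.mem_univ, true_and] at hp
      exact hp.2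
    rw [hC, le_div_iff₀ hnpos]
    exact hPeel k m n hn r u f hf' p hp'
  -- the number of witnesses
  have hFinj_card : (Finj.card : ℝ) ≤ (m : ℝ) ^ u := by
    have h1 : Finj.card ≤ m ^ u := by
      refine (Finset.card_filter_le _ _).trans ?_
      rw [Finset.card_univ, Fintype.card_fun, Fintype.card_fin, Fintype.card_fin]
    exact_mod_cast h1
  have hPm_card : (Pm.card : ℝ) ≤ (4 : ℝ) ^ u := by
    have h1 : Pm.card ≤ (Finset.univ.filter fun p : Fin u → Fin u => Monotone p).card := by
      refine Finset.card_le_card ?_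
      intro p hp
      simp only [hPm, Finset.mem_filter, Finset.mem_univ, true_and] at hp ⊢
      exact hp.1
    have h2 : (Finset.univ.filter fun p : Fin u → Fin u => Monotone p).card ≤ 4 ^ u := by
      rw [← Fintype.card_subtype]
      exact hBfs.2 u
    exact_mod_cast h1.trans h2
  have hN0 : (0 : ℝ) ≤ N := Nat.cast_nonneg _
  have hC0 : (0 : ℝ) ≤ C := by positivity
  calc (B.card : ℝ) ≤ ((∑ r : Fin k, ∑ f ∈ Finj, ∑ p ∈ Pm, (E r f p).card : ℕ) : ℝ) := by
        exact_mod_cast hcard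
    _ = ∑ r : Fin k, ∑ f ∈ Finj, ∑ p ∈ Pm, ((E r f p).card : ℝ) := by push_cast; rfl
    _ ≤ ∑ _r : Fin k, ∑ _f ∈ Finj, ∑ _p ∈ Pm, C :=
        Finset.sum_le_sum fun r _ => Finset.sum_le_sum fun f hf => Finset.sum_le_sum fun p hp =>
          hone r f hf p hp
    _ = (k : ℝ) * ((Finj.card : ℝ) * ((Pm.card : ℝ) * C)) := by
        simp only [Finset.sum_const, nsmul_eq_mul, Finset.card_univ, Fintype.card_fin]
    _ ≤ (k : ℝ) * ((m : ℝ) ^ u * ((4 : ℝ) ^ u * C)) := by gcongr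
    _ = (N : ℝ) * ((k : ℝ) * (m : ℝ) ^ u * (4 : ℝ) ^ u * ((2 * k : ℝ) ^ 2 / n) ^ (u - 1)) := by
        rw [hC, div_pow]; ring
    _ ≤ (N : ℝ) * (1 / 4) := mul_le_mul_of_nonneg_left hsmall hN0
    _ = (N : ℝ) / 4 := by ring

/-- **Good paths are at least half of all paths.** If a set `E` of path tuples contains every tuple all
of whose splice instances `P r q` (`q ≤ mk`) satisfy Hall's condition and all of whose pooled
clause-sharing components have `< u` clauses, then `#E ≥ #Paths / 2`: the complement of `E` is covered
by the two bad sets of `lds_hallBad_card` and `lds_compBad_card`, each of size `≤ #Paths / 4`. -/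
theorem lds_good_card (k m n u : ℕ) (hk : 1 ≤ k) (hn : 1 ≤ n) (hmn : m ≤ n) (hu : 1 ≤ u)
    (hBfs : (∀ {V : Type} [Fintype V] [DecidableEq V] (R : V → V → Prop) (a : V) (u : ℕ) (hu : 1 ≤ u),
      (∃ e : Fin u → V, Function.Injective e ∧ ∀ i, Relation.ReflTransGen R a (e i)) →
      ∃ f : Fin u → V, Function.Injective f ∧ f ⟨0, hu⟩ = a ∧
        ∃ p : Fin u → Fin u, Monotone p ∧ ∀ i : Fin u, (i : ℕ) ≠ 0 → p i < i ∧ R (f (p i)) (f i)) ∧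
      ∀ u : ℕ, Fintype.card {p : Fin u → Fin u // Monotone p} ≤ 4 ^ u)
    (hHall : ∀ (k m n : ℕ), 1 ≤ k → 1 ≤ n → m ≤ n → ∀ (r : Fin k) (q : ℕ),
      (((Finset.univ : Finset (Fin (k + 1) → Fin m → Fin k → Fin n × Bool)).filter fun Ψ =>
          ∃ T : Finset (Fin m),
            (T.biUnion fun i => Finset.univ.image fun j : Fin k =>
              (if (i : ℕ) * k + j < q then Ψ r.succ i j else Ψ r.castSucc i j).1).card < T.card).card : ℝ)
        ≤ (Fintype.card (Fin (k + 1) → Fin m → Fin k → Fin n × Bool) : ℝ) *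
          ∑ c ∈ Finset.Icc 2 m, ((m.choose c : ℕ) : ℝ) * ((n.choose (c - 1) : ℕ) : ℝ) *
            (((c - 1 : ℕ) : ℝ) / n) ^ (k * c))
    (hPeel : ∀ (k m n : ℕ), 1 ≤ n → ∀ (r : Fin k) (u : ℕ) (f : Fin u → Fin m),
      Function.Injective f → ∀ (p : Fin u → Fin u), (∀ i : Fin u, (i : ℕ) ≠ 0 → p i < i) →
      (((Finset.univ : Finset (Fin (k + 1) → Fin m → Fin k → Fin n × Bool)).filter fun Ψ =>
          ∀ i : Fin u, (i : ℕ) ≠ 0 → ∃ j j' : Fin k, ∃ ρ ρ' : Fin (k + 1),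
            (ρ = r.castSucc ∨ ρ = r.succ) ∧ (ρ' = r.castSucc ∨ ρ' = r.succ) ∧
            (Ψ ρ (f (p i)) j).1 = (Ψ ρ' (f i) j').1).card : ℝ) * (n : ℝ) ^ (u - 1)
        ≤ ((2 * k : ℝ) ^ 2) ^ (u - 1) *
          Fintype.card (Fin (k + 1) → Fin m → Fin k → Fin n × Bool))
    (hsmall₁ : (k : ℝ) * ((m : ℝ) * k + 1) *
        (∑ c' ∈ Finset.Icc 2 m, ((m.choose c' : ℕ) : ℝ) *
          ((n.choose (c' - 1) : ℕ) : ℝ) * (((c' - 1 : ℕ) : ℝ) / n) ^ (k * c')) ≤ 1 / 4)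
    (hsmall₂ : (k : ℝ) * (m : ℝ) ^ u * (4 : ℝ) ^ u * ((2 * k : ℝ) ^ 2 / n) ^ (u - 1) ≤ 1 / 4)
    (E : Finset (Fin (k + 1) → Fin m → Fin k → Fin n × Bool))
    (hE : ∀ Ψ : Fin (k + 1) → Fin m → Fin k → Fin n × Bool,
      (∀ (r : Fin k) (q : ℕ), q ≤ m * k → ∀ T : Finset (Fin m), T.card ≤
        (T.biUnion fun i => Finset.univ.image fun j : Fin k =>
          (if (i : ℕ) * k + j < q then Ψ r.succ i j else Ψ r.castSucc i j).1).card) →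
      (∀ (r : Fin k) (a : Fin m), (Finset.univ.filter fun a' : Fin m => Relation.ReflTransGen
        (fun a a' : Fin m => ∃ j j' : Fin k, ∃ ρ ρ' : Fin (k + 1),
          (ρ = r.castSucc ∨ ρ = r.succ) ∧ (ρ' = r.castSucc ∨ ρ' = r.succ) ∧
          (Ψ ρ a j).1 = (Ψ ρ' a' j').1) a a').card < u) →
      Ψ ∈ E) :
    (Fintype.card (Fin (k + 1) → Fin m → Fin k → Fin n × Bool) : ℝ) / 2 ≤ E.card := by
  have hB₁ := lds_hallBad_card k m n hk hn hmn hHall hsmall₁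
  have hB₂ := lds_compBad_card k m n hn u hu hBfs hPeel hsmall₂
  set N := Fintype.card (Fin (k + 1) → Fin m → Fin k → Fin n × Bool) with hN
  set B₁ : Finset (Fin (k + 1) → Fin m → Fin k → Fin n × Bool) :=
    (Finset.univ : Finset (Fin (k + 1) → Fin m → Fin k → Fin n × Bool)).filter fun Ψ =>
        ∃ r : Fin k, ∃ q : ℕ, q ≤ m * k ∧ ∃ T : Finset (Fin m),
          (T.biUnion fun i => Finset.univ.image fun j : Fin k =>
            (if (i : ℕ) * k + j < q then Ψ r.succ i j else Ψ r.castSucc i j).1).card < T.card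
    with hB₁_def
  set B₂ : Finset (Fin (k + 1) → Fin m → Fin k → Fin n × Bool) :=
    (Finset.univ : Finset (Fin (k + 1) → Fin m → Fin k → Fin n × Bool)).filter fun Ψ =>
        ∃ r : Fin k, ∃ a : Fin m, u ≤ (Finset.univ.filter fun a' : Fin m => Relation.ReflTransGen
          (fun a a' : Fin m => ∃ j j' : Fin k, ∃ ρ ρ' : Fin (k + 1),
            (ρ = r.castSucc ∨ ρ = r.succ) ∧ (ρ' = r.castSucc ∨ ρ' = r.succ) ∧
            (Ψ ρ a j).1 = (Ψ ρ' a' j').1) a a').card with hB₂_def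
  -- every path tuple is good or bad
  have hcov : (Finset.univ : Finset (Fin (k + 1) → Fin m → Fin k → Fin n × Bool)) ⊆
      E ∪ (B₁ ∪ B₂) := by
    intro Ψ _
    by_cases h₁ : ∀ (r : Fin k) (q : ℕ), q ≤ m * k → ∀ T : Finset (Fin m), T.card ≤
        (T.biUnion fun i => Finset.univ.image fun j : Fin k =>
          (if (i : ℕ) * k + j < q then Ψ r.succ i j else Ψ r.castSucc i j).1).card
    · by_cases h₂ : ∀ (r : Fin k) (a : Fin m), (Finset.univ.filter fun a' : Fin m =>
          Relation.ReflTransGen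
            (fun a a' : Fin m => ∃ j j' : Fin k, ∃ ρ ρ' : Fin (k + 1),
              (ρ = r.castSucc ∨ ρ = r.succ) ∧ (ρ' = r.castSucc ∨ ρ' = r.succ) ∧
              (Ψ ρ a j).1 = (Ψ ρ' a' j').1) a a').card < u
      · exact Finset.mem_union_left _ (hE Ψ h₁ h₂)
      · push Not at h₂
        obtain ⟨r, a, hra⟩ := h₂
        refine Finset.mem_union_right _ (Finset.mem_union_right _ ?_)
        simp only [hB₂_def, Finset.mem_filter, Finset.mem_univ, true_and]
        exact ⟨r, a, hra⟩
    · push Not at h₁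
      obtain ⟨r, q, hq, T, hT⟩ := h₁
      refine Finset.mem_union_right _ (Finset.mem_union_left _ ?_)
      simp only [hB₁_def, Finset.mem_filter, Finset.mem_univ, true_and]
      exact ⟨r, q, hq, T, hT⟩
  have hcardN : N ≤ E.card + (B₁.card + B₂.card) := by
    have h := Finset.card_le_card hcov
    rw [Finset.card_univ] at h
    exact h.trans ((Finset.card_union_le _ _).trans
      (Nat.add_le_add_left (Finset.card_union_le _ _) _))
  have hreal : (N : ℝ) ≤ E.card + (B₁.card + B₂.card) := by exact_mod_cast hcardN
  linarith

end Summit.PneNP.PneNP.Cruxes.SolvableImpliesStableSection.Sketch
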